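import Summits.CriticalPhenomena.PercolationContinuityZ3.Theorems.Transplant.SkelPhiFaceDataNb
import Summits.CriticalPhenomena.PercolationContinuityZ3.Theorems.Transplant.SkelPhiRootFootRun
import Summits.CriticalPhenomena.PercolationContinuityZ3.Theorems.Transplant.SkelPhiParaRunChain
import HarnessLib

/-!
# N1 ({±1} node), (F) inner route under RULING B.15, part R4b-i (hp-8 g33): **READINGS FOR THE FACE ROUTE'S ROOMS** — the three conversions
# that let p3-g9's root-numbers machinery (footprint boxes `FootBox … (fineSkel φ c …)` read at the BASE `c` = the kit centre) serve the face step,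
# whose cell map is the fine skeleton based at the window centre `w₀`:
# (a) the BASE CHANGE of the fine skeleton — `|FS_{w₀} w i − (FS_c w i + FS_{w₀} c i)| ≤ 1` (floors of linear forms);
# (b) the HABITAT conversion — a footprint box about `c` whose shift by the contact's cell `z_c := FS_{w₀} c` (± 1) lies in the far rows
#     `farAS₂ x du j` thickened transversally by `k₀` puts the vertex's cell in `farCore x du j k₀`, the planar set whose frame window lies in the
#     face-step region (`Win_subset_stepRgNb`);
# (c) the TARGET conversion — a footprint box about `c` landing (after the shift) inside `cen (x+du) ± (b₀ − 2)` puts the vertex in the small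
#     arrival box `M_{a'}(x+du) = VWin ψ (Mb b₀ (x+du)) rM` of the twin scheme (a weak-step neighbour stays inside `± b₀`);
# (d) the numeric CROSS LINK from the last core of an x-run at `c_L` to core `0` of a y′-run at `c_T` (`φ c_T = φ c_L + y_T`), and its mirror.

builds on p205010 (kernel theorem, internal audit signed; external expert review pending) — nothing in this file uses p205010; nothing here is a
claim about the open node `SamePDropOfSkeletonNeg`.
Lane `prim-bschramm`, seat `prim-hp-8` (gen 33); helper file (`--supports stmt-CriticalPhenomena-4575 --as helper`).
* §1 `abs_ediv_add_sub_le_one`, **`abs_fineSkel_base_change`**; §2 `PCells2.farCore`, `mem_farCore_iff`, `farCore_spec`, **`mem_farCore_of_footBox`**;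
* §3 **`mem_Mb_win_of_footBox`**; §4 **`runY_core_zero_of_runX_core`**, **`runX_core_zero_of_runY_core`**.
[cite: KozmaNitzan2024, §4 p. 26 (M_v, E_{v,x}), Lemma 11 (pp. 22–23), Lemma 12 (pp. 23–25)] [cite: MartineauTassion2017, §4.1, §4.3]
-/

noncomputable section

open scoped Classical

namespace Summit.CriticalPhenomena.PercolationContinuityZ3.Theorems.Transplant

open Literature.Probability.Percolation Literature.Probability.LatticeModels SimpleGraph KNCells
open Literature.Probability.Percolation.KozmaNitzan
open Literature.Probability.Percolation.KozmaNitzan.Cells (oth oth_ne sgOf sgOf_sign stepVec_apply_fst stepVec_apply_oth eq_oth_of_ne oth_oth)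
open Literature.Barriers.CriticalPhenomena (graphBall graphBall_finite mem_graphBall_self graphBall_mono)
open BoxProdZ2 (ConcRadiiG)
open TwoAxis.Para (coarse lam0 lam1 bp)

variable {V : Type} {G : SimpleGraph V} [G.LocallyFinite] {φ : V → Site 2}

/-! ## §1 The base change of the fine skeleton -/

/-- `|⌊(x + y − s)/D⌋ − ⌊x/D⌋ − ⌊y/D⌋| ≤ 1` for `0 ≤ s < D`. [folklore] -/
theorem abs_ediv_add_sub_le_one {x y s D : ℤ} (hD : 0 < D) (hs0 : 0 ≤ s) (hsD : s < D) :
    |(x + y - s) / D - x / D - y / D| ≤ 1 := by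
  have hx := Int.mul_ediv_add_emod x D
  have hy := Int.mul_ediv_add_emod y D
  have hx0 := Int.emod_nonneg x hD.ne'
  have hxD := Int.emod_lt_of_pos x hD
  have hy0 := Int.emod_nonneg y hD.ne'
  have hyD := Int.emod_lt_of_pos y hD
  have key : (x + y - s) / D = x / D + y / D + (x % D + y % D - s) / D := by
    have e : x + y - s = (x % D + y % D - s) + D * (x / D + y / D) := by rw [mul_add]; linarith
    rw [e, Int.add_mul_ediv_left _ _ hD.ne']; ring
  rw [key]
  have h1 : -1 ≤ (x % D + y % D - s) / D := by
    rw [Int.le_ediv_iff_mul_le hD]; linarith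
  have h2 : (x % D + y % D - s) / D ≤ 1 := by
    rw [← Int.lt_add_one_iff, Int.ediv_lt_iff_lt_mul hD]; linarith
  rw [abs_le]; constructor <;> linarith

namespace Skelφ

/-- **BASE CHANGE OF THE FINE SKELETON**: for the fine skeleton with half-shift `D/2`, the cell of `w` read from base `t₀` differs from (its cell read
from base `c`) + (the cell of `c` read from `t₀`) by at most one, in each coordinate. [folklore] -/
theorem abs_fineSkel_base_change (t₀ c w : V) (A n h vα vβ c₀ c₁ : ℤ) {D : ℤ} (hD : 0 < D) (i : Fin 2) :
    |fineSkel φ t₀ A n h vα vβ c₀ c₁ (D / 2) (D / 2) D w i -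
      (fineSkel φ c A n h vα vβ c₀ c₁ (D / 2) (D / 2) D w i + fineSkel φ t₀ A n h vα vβ c₀ c₁ (D / 2) (D / 2) D c i)| ≤ 1 := by
  have hs0 : 0 ≤ D / 2 := Int.ediv_nonneg hD.le (by norm_num)
  have hsD : D / 2 < D := by omega
  have hrel : relφ φ t₀ w = relφ φ c w + relφ φ t₀ c := by funext k; simp [relφ]
  obtain rfl | rfl : i = 0 ∨ i = 1 := by fin_cases i <;> simp
  · simp only [fineSkel_apply_zero]
    rw [hrel]
    have hlin : lam0 A vα vβ (relφ φ c w + relφ φ t₀ c) = lam0 A vα vβ (relφ φ c w) + lam0 A vα vβ (relφ φ t₀ c) := by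
      simp only [lam0, Pi.add_apply]; ring
    rw [hlin]
    unfold coarse
    have e : c₀ * (lam0 A vα vβ (relφ φ c w) + lam0 A vα vβ (relφ φ t₀ c)) + D / 2 =
        (c₀ * lam0 A vα vβ (relφ φ c w) + D / 2) + (c₀ * lam0 A vα vβ (relφ φ t₀ c) + D / 2) - D / 2 := by ring
    rw [e]
    have := abs_ediv_add_sub_le_one (x := c₀ * lam0 A vα vβ (relφ φ c w) + D / 2) (y := c₀ * lam0 A vα vβ (relφ φ t₀ c) + D / 2) hD hs0 hsD
    rwa [show ∀ a b q : ℤ, a - (b + q) = a - b - q from fun a b q => by ring]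
  · simp only [fineSkel_apply_one]
    rw [hrel]
    have hlin : lam1 A n h (relφ φ c w + relφ φ t₀ c) = lam1 A n h (relφ φ c w) + lam1 A n h (relφ φ t₀ c) := by
      simp only [lam1, bp, Pi.add_apply]; ring
    rw [hlin]
    unfold coarse
    have e : c₁ * (lam1 A n h (relφ φ c w) + lam1 A n h (relφ φ t₀ c)) + D / 2 =
        (c₁ * lam1 A n h (relφ φ c w) + D / 2) + (c₁ * lam1 A n h (relφ φ t₀ c) + D / 2) - D / 2 := by ring
    rw [e]
    have := abs_ediv_add_sub_le_one (x := c₁ * lam1 A n h (relφ φ c w) + D / 2) (y := c₁ * lam1 A n h (relφ φ t₀ c) + D / 2) hD hs0 hsD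
    rwa [show ∀ a b q : ℤ, a - (b + q) = a - b - q from fun a b q => by ring]

end Skelφ

/-! ## §2 The habitat conversion -/

namespace PCells2

variable (P : PCells2)

/-- **The far core**: the cells of `farAS₂ x du j` whose transverse `k₀`-thickening at the same level stays in `farAS₂ x du j` (the planar set of the
face route's habitat: its frame window lies in the face-step region). [this work] -/
def farCore (x : Site 2) (du : MDir) (j : ℕ) (k₀ : ℤ) : Finset (Site 2) :=
  (P.farAS₂ x du j).filter fun z => ∀ z' : Site 2, z' du.1 = z du.1 → |z' (oth du.1) - z (oth du.1)| ≤ k₀ → z' ∈ P.farAS₂ x du j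

/-- The defining property of the far core. [folklore] -/
theorem farCore_spec {x : Site 2} {du : MDir} {j : ℕ} {k₀ : ℤ} :
    ∀ z ∈ P.farCore x du j k₀, ∀ z' : Site 2, z' du.1 = z du.1 → |z' (oth du.1) - z (oth du.1)| ≤ k₀ → z' ∈ P.farAS₂ x du j :=
  fun _ hz => (Finset.mem_filter.1 hz).2

/-- **Membership in the far core from level/transverse bounds** (`0 ≤ k₀`). [folklore] -/
theorem mem_farCore_of_bounds {x : Site 2} {du : MDir} {j : ℕ} {k₀ : ℤ} (hk₀ : 0 ≤ k₀) {t : Site 2}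
    (h1 : 5 * (P.r du.1 : ℤ) + 10 * P.s du.1 * j + 2 ≤ P.lev du x t) (h2 : P.lev du x t ≤ 25 * P.r du.1 - 1)
    (h3 : |t (oth du.1) - P.cen x (oth du.1)| + k₀ ≤ 5 * P.r (oth du.1) - 3) : t ∈ P.farCore x du j k₀ := by
  refine Finset.mem_filter.2 ⟨P.mem_farAS₂_of_bounds h1 h2 (by linarith [abs_nonneg (t (oth du.1) - P.cen x (oth du.1))]), fun z' hz1 hz2 => ?_⟩
  have hlev : P.lev du x z' = P.lev du x t := by unfold lev; rw [hz1]
  refine P.mem_farAS₂_of_bounds (by rw [hlev]; exact h1) (by rw [hlev]; exact h2) ?_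
  calc |z' (oth du.1) - P.cen x (oth du.1)| = |(z' (oth du.1) - t (oth du.1)) + (t (oth du.1) - P.cen x (oth du.1))| := by ring_nf
    _ ≤ |z' (oth du.1) - t (oth du.1)| + |t (oth du.1) - P.cen x (oth du.1)| := abs_add_le _ _
    _ ≤ _ := by linarith

end PCells2

namespace Skelφ

/-- **HABITAT CONVERSION**: a vertex `w` whose base-`c` footprint lies in the box `FootBox flo fhi fw du`, with the contact's cell `z_c` (base `w₀`)
at level `lc := lev du x z_c` and transverse offset `|z_c ⊥ − cen x ⊥| ≤ wc`, has its base-`w₀` cell in `farCore x du j k₀` once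
`5r∥ + 10s∥j + 3 ≤ flo + lc`, `fhi + lc ≤ 25r∥ − 2`, `fw + wc + k₀ + 1 ≤ 5r⊥ − 3`. [cite: KozmaNitzan2024, §4 p. 26, Lemma 12] -/
theorem mem_farCore_of_footBox (P : PCells2) (t₀ c w : V) (A n h vα vβ c₀ c₁ : ℤ) {D : ℤ} (hD : 0 < D) {x : Site 2} {du : MDir} {j : ℕ}
    {k₀ flo fhi fw wc : ℤ} (hk₀ : 0 ≤ k₀)
    (hfb : FootBox flo fhi fw du (fineSkel φ c A n h vα vβ c₀ c₁ (D / 2) (D / 2) D w))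
    (hwc : |fineSkel φ t₀ A n h vα vβ c₀ c₁ (D / 2) (D / 2) D c (oth du.1) - P.cen x (oth du.1)| ≤ wc)
    (hlo : 5 * (P.r du.1 : ℤ) + 10 * P.s du.1 * j + 3 ≤ flo + P.lev du x (fineSkel φ t₀ A n h vα vβ c₀ c₁ (D / 2) (D / 2) D c))
    (hhi : fhi + P.lev du x (fineSkel φ t₀ A n h vα vβ c₀ c₁ (D / 2) (D / 2) D c) ≤ 25 * P.r du.1 - 2)
    (hw : fw + wc + k₀ + 1 ≤ 5 * (P.r (oth du.1) : ℤ) - 3) :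
    fineSkel φ t₀ A n h vα vβ c₀ c₁ (D / 2) (D / 2) D w ∈ P.farCore x du j k₀ := by
  set zw := fineSkel φ t₀ A n h vα vβ c₀ c₁ (D / 2) (D / 2) D w with hzw
  set zc := fineSkel φ t₀ A n h vα vβ c₀ c₁ (D / 2) (D / 2) D c with hzc
  set zr := fineSkel φ c A n h vα vβ c₀ c₁ (D / 2) (D / 2) D w with hzr
  have hbc : ∀ i, |zw i - (zr i + zc i)| ≤ 1 := fun i => abs_fineSkel_base_change t₀ c w A n h vα vβ c₀ c₁ hD i
  obtain ⟨hf1, hf2, hf3⟩ := hfb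
  have hsg := sgOf_sign du
  have ha := abs_le.1 (hbc du.1)
  have hb := abs_le.1 (hbc (oth du.1))
  have hc' := abs_le.1 hwc
  have hf3' := abs_le.1 hf3
  refine P.mem_farCore_of_bounds hk₀ ?_ ?_ ?_
  · unfold PCells2.lev at hlo ⊢
    rcases hsg with hs | hs <;> rw [hs] at hf1 hlo ⊢ <;> nlinarith
  · unfold PCells2.lev at hhi ⊢
    rcases hsg with hs | hs <;> rw [hs] at hf2 hhi ⊢ <;> nlinarith
  · have : |zw (oth du.1) - P.cen x (oth du.1)| ≤ fw + wc + 1 := by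
      rw [abs_le]; constructor <;> linarith
    linarith

/-! ## §3 The target conversion -/

/-- **TARGET CONVERSION**: a vertex `w ∈ B(w₀, R)` (`R + 1 ≤ rM`) whose base-`c` footprint lies in `FootBox glo ghi gw du` landing, after the shift by
the contact's cell `z_c`, inside `cen (x+du) ± (b₀ − 2)` lies in the small arrival box `VWin ψ w₀ (Mb b₀ (x + du)) rM` (a weak-step neighbour of
controlled footprint stays in `± b₀`). [cite: KozmaNitzan2024, §4 p. 26 (M_v), Lemma 11 (p. 22)] -/
theorem mem_Mb_win_of_footBox [DecidableEq V] (P : PCells2) (t₀ c : V) (A n h vα vβ c₀ c₁ : ℤ) {D : ℤ} (hD : 0 < D)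
    (hlip : Lip G (fineSkel φ t₀ A n h vα vβ c₀ c₁ (D / 2) (D / 2) D)) (hws : WeakSteps G (fineSkel φ t₀ A n h vα vβ c₀ c₁ (D / 2) (D / 2) D))
    {x : Site 2} {du : MDir} {b₀ : Fin 2 → ℕ} {R rM : ℕ} (hR : R + 1 ≤ rM) {glo ghi gw : ℤ} {w : V} (hwB : w ∈ graphBall G t₀ R)
    (hfb : FootBox glo ghi gw du (fineSkel φ c A n h vα vβ c₀ c₁ (D / 2) (D / 2) D w))
    (hpar : ∀ s : ℤ, glo ≤ s → s ≤ ghi →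
      |sgOf du * s + fineSkel φ t₀ A n h vα vβ c₀ c₁ (D / 2) (D / 2) D c du.1 - P.cen (x + stepVec du) du.1| + 2 ≤ b₀ du.1)
    (hperp : gw + |fineSkel φ t₀ A n h vα vβ c₀ c₁ (D / 2) (D / 2) D c (oth du.1) - P.cen (x + stepVec du) (oth du.1)| + 2 ≤ b₀ (oth du.1)) :
    w ∈ VWin G (fineSkel φ t₀ A n h vα vβ c₀ c₁ (D / 2) (D / 2) D) t₀ (P.Mb b₀ (x + stepVec du)) rM := by
  set FS := fineSkel φ t₀ A n h vα vβ c₀ c₁ (D / 2) (D / 2) D with hFS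
  set zr := fineSkel φ c A n h vα vβ c₀ c₁ (D / 2) (D / 2) D w with hzr
  have hbc : ∀ i, |FS w i - (zr i + FS c i)| ≤ 1 := fun i => abs_fineSkel_base_change t₀ c w A n h vα vβ c₀ c₁ hD i
  obtain ⟨hf1, hf2, hf3⟩ := hfb
  have hsg := sgOf_sign du
  -- the cell of `w` is within `b₀ − 1` of `cen (x + du)`
  have hin : ∀ i, |FS w i - P.cen (x + stepVec du) i| + 1 ≤ b₀ i := by
    intro i
    by_cases hi : i = du.1
    · subst hi
      have hp := hpar (sgOf du * zr du.1) hf1 hf2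
      have hs2 : sgOf du * (sgOf du * zr du.1) = zr du.1 := by
        rcases hsg with hs | hs <;> rw [hs] <;> ring
      rw [hs2] at hp
      have h1 := abs_le.1 (hbc du.1)
      have : |FS w du.1 - P.cen (x + stepVec du) du.1| ≤ |zr du.1 + FS c du.1 - P.cen (x + stepVec du) du.1| + 1 := by
        calc |FS w du.1 - P.cen (x + stepVec du) du.1|
            = |(FS w du.1 - (zr du.1 + FS c du.1)) + (zr du.1 + FS c du.1 - P.cen (x + stepVec du) du.1)| := by ring_nf
          _ ≤ |FS w du.1 - (zr du.1 + FS c du.1)| + |zr du.1 + FS c du.1 - P.cen (x + stepVec du) du.1| := abs_add_le _ _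
          _ ≤ _ := by linarith [hbc du.1]
      linarith
    · rw [eq_oth_of_ne hi]
      have : |FS w (oth du.1) - P.cen (x + stepVec du) (oth du.1)| ≤ gw + |FS c (oth du.1) - P.cen (x + stepVec du) (oth du.1)| + 1 := by
        calc |FS w (oth du.1) - P.cen (x + stepVec du) (oth du.1)|
            = |(FS w (oth du.1) - (zr (oth du.1) + FS c (oth du.1))) + zr (oth du.1) + (FS c (oth du.1) - P.cen (x + stepVec du) (oth du.1))| := by
              ring_nf
          _ ≤ |(FS w (oth du.1) - (zr (oth du.1) + FS c (oth du.1))) + zr (oth du.1)| + |FS c (oth du.1) - P.cen (x + stepVec du) (oth du.1)| :=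
              abs_add_le _ _
          _ ≤ |FS w (oth du.1) - (zr (oth du.1) + FS c (oth du.1))| + |zr (oth du.1)| + |FS c (oth du.1) - P.cen (x + stepVec du) (oth du.1)| := by
              linarith [abs_add_le (FS w (oth du.1) - (zr (oth du.1) + FS c (oth du.1))) (zr (oth du.1))]
          _ ≤ _ := by linarith [hbc (oth du.1)]
      linarith
  -- a weak-step neighbour, both cells in `Mb`
  obtain ⟨m, hadj, -⟩ := hws w 0 1
  have hMv : ∀ s : Site 2, (∀ i, |s i - P.cen (x + stepVec du) i| ≤ b₀ i) → s ∈ P.Mb b₀ (x + stepVec du) := fun s hs => by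
    rw [PCells2.mem_Mb_iff]
    intro i
    have := abs_le.1 (hs i)
    constructor <;> linarith
  have hyM : FS w ∈ P.Mb b₀ (x + stepVec du) := hMv _ fun i => by have := hin i; linarith
  have hmM : FS m ∈ P.Mb b₀ (x + stepVec du) := hMv _ fun i => by
    have h1 := hlip hadj i
    have h2 := hin i
    calc |FS m i - P.cen (x + stepVec du) i| = |(FS m i - FS w i) + (FS w i - P.cen (x + stepVec du) i)| := by ring_nf
      _ ≤ |FS m i - FS w i| + |FS w i - P.cen (x + stepVec du) i| := abs_add_le _ _
      _ ≤ _ := by rw [abs_sub_comm] at h1; linarith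
  exact mem_VWin_of_adj_footprints hwB hR hadj hyM hmM

/-! ## §4 The numeric cross links between an x-run and a y′-run -/

/-- **CROSS LINK, x-RUN → y′-RUN**: a vertex in core `k` of the x-run schedule `xRunSched n ℓ h R′ q N` read in `runX φ c_L n h σ` lies in core `0`
of the y′-run schedule `yRunSched … R′₃ q₃ N₃` read in `runY φ c_T n h σ_T` (`φ c_T = φ c_L + y_T`), as soon as the numeric images of the x-core box
satisfy core `0`'s four inequalities. [cite: KozmaNitzan2024, §4 Lemma 12 (pp. 23–25)] -/
theorem runY_core_zero_of_runX_core {cL cT : V} {n : ℕ} (hn : 1 ≤ n) {h : ℤ} {σ σT : ℤ} (hσ : σ = 1 ∨ σ = -1)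
    {ℓ R' q N : ℕ} {v : ℤ} (hv : |v| ≤ n) (hlay : (n + h.natAbs : ℕ) ≤ (n : ℤ) * ℓ + 1) (R'₃ q₃ N₃ : ℕ) {yT : Site 2} (hcT : φ cT = φ cL + yT)
    {k : ℕ}
    (hnum : ∀ a s : ℤ, (xPrmW n ℓ h R' q N).aLo k ≤ a → a ≤ (xPrmW n ℓ h R' q N).aHi k →
      (xPrmW n ℓ h R' q N).bLo k ≤ s / (shearUnit n h : ℤ) → s / (shearUnit n h : ℤ) ≤ (xPrmW n ℓ h R' q N).bHi k →
      (yPrmW n ℓ h v R'₃ q₃ N₃).InCore 0 ((σT * σ * s - σT * ((n : ℤ) * yT 1 - h * yT 0)) / (shearUnit n h : ℤ)) (σT * σ * a - σT * yT 0))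
    {w : V} (hw : runX φ cL n h σ w ∈ (xRunSched n ℓ h R' q N).core k) :
    runY φ cT n h σT w ∈ (yRunSched hn hv hlay R'₃ q₃ N₃).core 0 := by
  rw [xRunSched, mem_scheduleN_core_iff (xPrmW_ok n ℓ h R' q N) (xPrmW_eb n ℓ h R' q N)] at hw
  rw [yRunSched, mem_scheduleN_core_iff (yPrmW_ok hn hv hlay R'₃ q₃ N₃) (yPrmW_eb n ℓ h v R'₃ q₃ N₃)]
  obtain ⟨h1, h2, h3, h4⟩ := hw
  rw [runX_zero] at h1 h2
  rw [runX_one] at h3 h4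
  have hσsq : σ * σ = 1 := by rcases hσ with rfl | rfl <;> norm_num
  have key := hnum (σ * relCoord φ cL 0 w) (σ * shearCoord φ cL n h w) h1 h2 h3 h4
  have e0 : runY φ cT n h σT w 1 = σT * σ * (σ * relCoord φ cL 0 w) - σT * yT 0 := by
    rw [runY_one, relCoord_apply, relCoord_apply, hcT, Pi.add_apply]
    have : σT * σ * (σ * (φ w 0 - φ cL 0)) = σT * (σ * σ) * (φ w 0 - φ cL 0) := by ring
    rw [this, hσsq]; ring
  have e1 : runY φ cT n h σT w 0 = (σT * σ * (σ * shearCoord φ cL n h w) - σT * ((n : ℤ) * yT 1 - h * yT 0)) / (shearUnit n h : ℤ) := by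
    rw [runY_zero, shearCoord_apply, shearCoord_apply, hcT, Pi.add_apply, Pi.add_apply]
    congr 1
    have : σT * σ * (σ * ((n : ℤ) * (φ w 1 - φ cL 1) - h * (φ w 0 - φ cL 0))) = σT * (σ * σ) * ((n : ℤ) * (φ w 1 - φ cL 1) - h * (φ w 0 - φ cL 0)) := by
      ring
    rw [this, hσsq]; ring
  rw [e0, e1]
  exact key

/-- **CROSS LINK, y′-RUN → x-RUN** (the mirror: the along y′-run's last core into core `0` of a tangential x-run at `c_T`, `φ c_T = φ c_L + y_T`).
[cite: KozmaNitzan2024, §4 Lemma 12 (pp. 23–25)] -/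
theorem runX_core_zero_of_runY_core {cL cT : V} {n : ℕ} (hn : 1 ≤ n) {h : ℤ} {σ σT : ℤ} (hσ : σ = 1 ∨ σ = -1)
    {ℓ R' q N : ℕ} {v : ℤ} (hv : |v| ≤ n) (hlay : (n + h.natAbs : ℕ) ≤ (n : ℤ) * ℓ + 1) (R'₃ q₃ N₃ : ℕ) {yT : Site 2} (hcT : φ cT = φ cL + yT)
    {k : ℕ}
    (hnum : ∀ a s : ℤ, (yPrmW n ℓ h v R' q N).aLo k ≤ s / (shearUnit n h : ℤ) → s / (shearUnit n h : ℤ) ≤ (yPrmW n ℓ h v R' q N).aHi k →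
      (yPrmW n ℓ h v R' q N).bLo k ≤ a → a ≤ (yPrmW n ℓ h v R' q N).bHi k →
      (xPrmW n ℓ h R'₃ q₃ N₃).InCore 0 (σT * σ * a - σT * yT 0) ((σT * σ * s - σT * ((n : ℤ) * yT 1 - h * yT 0)) / (shearUnit n h : ℤ)))
    {w : V} (hw : runY φ cL n h σ w ∈ (yRunSched hn hv hlay R' q N).core k) :
    runX φ cT n h σT w ∈ (xRunSched n ℓ h R'₃ q₃ N₃).core 0 := by
  rw [yRunSched, mem_scheduleN_core_iff (yPrmW_ok hn hv hlay R' q N) (yPrmW_eb n ℓ h v R' q N)] at hw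
  rw [xRunSched, mem_scheduleN_core_iff (xPrmW_ok n ℓ h R'₃ q₃ N₃) (xPrmW_eb n ℓ h R'₃ q₃ N₃)]
  obtain ⟨h1, h2, h3, h4⟩ := hw
  rw [runY_zero] at h1 h2
  rw [runY_one] at h3 h4
  have hσsq : σ * σ = 1 := by rcases hσ with rfl | rfl <;> norm_num
  have key := hnum (σ * relCoord φ cL 0 w) (σ * shearCoord φ cL n h w) h1 h2 h3 h4
  have e0 : runX φ cT n h σT w 0 = σT * σ * (σ * relCoord φ cL 0 w) - σT * yT 0 := by
    rw [runX_zero, relCoord_apply, relCoord_apply, hcT, Pi.add_apply]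
    have : σT * σ * (σ * (φ w 0 - φ cL 0)) = σT * (σ * σ) * (φ w 0 - φ cL 0) := by ring
    rw [this, hσsq]; ring
  have e1 : runX φ cT n h σT w 1 = (σT * σ * (σ * shearCoord φ cL n h w) - σT * ((n : ℤ) * yT 1 - h * yT 0)) / (shearUnit n h : ℤ) := by
    rw [runX_one, shearCoord_apply, shearCoord_apply, hcT, Pi.add_apply, Pi.add_apply]
    congr 1
    have : σT * σ * (σ * ((n : ℤ) * (φ w 1 - φ cL 1) - h * (φ w 0 - φ cL 0))) = σT * (σ * σ) * ((n : ℤ) * (φ w 1 - φ cL 1) - h * (φ w 0 - φ cL 0)) := by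
      ring
    rw [this, hσsq]; ring
  rw [e0, e1]
  exact key

end Skelφ

end Summit.CriticalPhenomena.PercolationContinuityZ3.Theorems.Transplant

end
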